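import Summits.ValiantsHypothesis.ValiantsHypothesis.Theorems.LacunarySymmetroidMatrixDescartesCensusV19GShells2122Q046
import Summits.ValiantsHypothesis.ValiantsHypothesis.Theorems.LacunarySymmetroidMatrixDescartesCensusV19GShells2122Q047
import Summits.ValiantsHypothesis.ValiantsHypothesis.Theorems.LacunarySymmetroidMatrixDescartesCensusV19GShells2122Q048
/-!
# `MatrixDescartes` census — 2-SIDON `V = 19` layer, shells `21…22`: the exception list SHRUNK by the V19G rows (corollary, PART 1/1: chunk lists 1 and their row lemmas)

HONEST FRAMING.  Object-search cell `pub-symmetroid`; door-A item `DoorA26 = PosRootLawAt 2 6 19` (stmt-ValiantsHypothesis-19979; OPEN, typed, never asserted)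
and its sharper support rows `PosRootLawOn 2 6 18 d`.  COROLLARY (val-sym-door-p4 g6/g7) of `V19S.eighteen_sidon_shells2122R_sorted` (`…CensusV19SShells2122R`, untouched):
of its 26 named exceptions `V19S.s2122OpenR`, 6 (= 3 mirror pairs) are now CLOSED in the kernel by the rows `Census.eighteen_on_<d>` of the V19G data files
`…CensusV19GShells2122Q*` (engine-3 certificates for the engine-dead cells + val-sym-door-p5 g5's general-window certificates for the formerly OPEN cells, kit j285101+j286891+j285101+j286891,
replayed by `decide +kernel` through the checked checker `V19G`); the remaining 20 exceptions are `V19S.s2122OpenR2` (NOTHING is claimed about them).  THIS PART: the closed-support chunks 1 (lists + `eighteen_of_mem_closedR2_<i>`); the assembly is `…V19SShells2122R2`.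
Nothing here bears on the one-collision supports, on `ζ_sym(2,6)` over all supports (registers unchanged), on `DoorA26` itself, on `MatrixDescartes`
(stmt-ValiantsHypothesis-18050) or on `VP ≠ VNP`.

[folklore] Bookkeeping over kernel rows; elementary.
-/

-- the D-0017 layout repeats a namespace component (single-conjunct summit); the `dupNamespace` linter flags it; name mandated.
set_option linter.dupNamespace false

namespace Summit.ValiantsHypothesis.ValiantsHypothesis.Theorems.LacunarySymmetroidMatrixDescartes.Census.V19S

/-- From the list of values to the vector. [folklore] -/
private theorem eq_vec_of_list_eq {d : Fin 6 → ℕ} {a0 a1 a2 a3 a4 a5 : ℕ} (h : [d 0, d 1, d 2, d 3, d 4, d 5] = [a0, a1, a2, a3, a4, a5]) :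
    d = ![a0, a1, a2, a3, a4, a5] := by
  simp only [List.cons.injEq, and_true] at h
  obtain ⟨h0, h1, h2, h3, h4, h5⟩ := h
  funext i; fin_cases i <;> simp [h0, h1, h2, h3, h4, h5]

/-- Chunk 1/1 of the 6 formerly excepted supports now carrying a kernel row `Census.eighteen_on_<d>`. [folklore] -/
def s2122ClosedR2_1 : List (List ℕ) :=
  [[0, 2, 7, 17, 18, 21], [0, 2, 8, 17, 18, 21], [0, 2, 10, 16, 17, 21], [0, 3, 4, 13, 19, 21], [0, 3, 4, 14, 19, 21], [0, 4, 5, 11, 19, 21]]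

/-- The supports of chunk 1 carry `ζ(2,6; d) ≤ 18` (kernel rows `Census.eighteen_on_<d>`). [folklore] -/
theorem eighteen_of_mem_closedR2_1 (d : Fin 6 → ℕ) (hmem : [d 0, d 1, d 2, d 3, d 4, d 5] ∈ s2122ClosedR2_1) : PosRootLawOn 2 6 18 d := by
  unfold s2122ClosedR2_1 at hmem
  simp only [List.mem_cons, List.mem_nil_iff, or_false] at hmem
  rcases hmem with h | h | h | h | h | h
  · rw [eq_vec_of_list_eq h]; exact eighteen_on_0_2_7_17_18_21
  · rw [eq_vec_of_list_eq h]; exact eighteen_on_0_2_8_17_18_21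
  · rw [eq_vec_of_list_eq h]; exact eighteen_on_0_2_10_16_17_21
  · rw [eq_vec_of_list_eq h]; exact eighteen_on_0_3_4_13_19_21
  · rw [eq_vec_of_list_eq h]; exact eighteen_on_0_3_4_14_19_21
  · rw [eq_vec_of_list_eq h]; exact eighteen_on_0_4_5_11_19_21

end Summit.ValiantsHypothesis.ValiantsHypothesis.Theorems.LacunarySymmetroidMatrixDescartes.Census.V19S
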